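import Summits.FinalStateConjecture.FinalStateConjecture.Theses.KillingDefectSpacetimeBound
import Literature.Geometry.Lorentzian.LateChartDilation
import Literature.Geometry.Lorentzian.KerrSchildHomogeneity
import Literature.Geometry.Lorentzian.KerrWaveDecay
import Literature.Geometry.Lorentzian.KerrFramedCompactness

/-!
# `SquareIntegrableCapture` (crux K1, stmt-FinalStateConjecture-18630, route
# `KillingDefectSpacetimeBound`): the LE-weighted leaf deviation `leafDev` VANISHES IDENTICALLY —
# the hypotheses `d_k(τ) ≤ δ₀` and `∫ d_k² ≤ η` of K1 are decoration (negative-side support,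
# refuter crux-attack seat)

`Spacetime.leafDev 𝓢 M₀ a₀ Ψ χ k τ` (HyperboloidalDefectFoliation.lean) is an infimum over fitted
parameters `M > 0`, `|a| ≤ χ M` and FREE re-chartings `Φ : B♯(M, a).domain → 𝓢` of the band, of
the LE-WEIGHTED sup `sup_x (1 + ‖y(x)‖)⁻¹ ‖Dᵐ(Φ^* g − g_{M,a})(x)‖`, the weight being evaluated at
the coordinate point `x` OF THE FREE RE-CHARTING.  The Kerr–Schild family is homothetic
(`Kerr.bilin_dilate`: `g_{λM,λa}(λx) = g_{M,a}(x)`), so `Φ_λ := Ψ ∘ (λ⁻¹ •)` defined on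
`B♯(λM₀, λa₀).domain = λ • B♯(M₀, a₀).domain` is an admissible re-charting with fitted parameters
`(λM₀, λa₀)` (same ratio `a/M`), its measured set lies in `{‖y‖ > λ M₀}`
(`Kerr.radius_le_spatialNorm`),
and its deviation is `y ↦ (λ⁻² Ψ^* g − g_{M₀,a₀})(λ⁻¹ y)` (`Spacetime.deviationExtend_comp_dilate`),
whose `Cᵏ` size does not grow (`supCkENorm_comp_smul_le`, `λ⁻¹ ≤ 1`).  Hence

* `leafDev_le_dilate` — `d_k(τ) ≤ (1 + λM₀)⁻¹ · ‖λ⁻² Ψ^*g − g_{M₀,a₀}‖_{Cᵏ(band)}` for every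
  `λ ≥ 1`;
* `supCkENorm_deviationExtend_constSmul_le` —
  `‖c Ψ^*g − g_{M₀,a₀}‖_{Cᵏ} ≤ ‖Ψ^*g‖_{Cᵏ} + ‖g_{M₀,a₀}‖_{Cᵏ}` for `0 < c ≤ 1`;
* `leafDev_eq_zero`, `leafDev_hypotheses_hold` — **`d_k(τ) = 0`** (so `d_k ≤ δ₀` and
  `∫ d_k² ≤ η` hold for every `δ₀, η`) as soon as `Ψ` is an admissible re-charting of its own band
  (smooth, smooth chart metric on the domain, injective on the saturation of the band — true for
  every honest foliation chart) and the chart metric and the Kerr metric have finite `Cᵏ` sup norm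
  on the (saturated) band (the former is the `ckBound` field of `IsHypKerrFoliation`, the latter is
  plain: `g_{M₀,a₀}` and its derivatives are bounded on `{r > M₀}`).

Consequences for the route (not formalised here; see the refuter's evidence note on the item):
the hypotheses `leafDev ≤ δ₀` and `∫⁻ leafDev² ≤ η` of `SquareIntegrableCapture` hold for free, so
K1 as typed asserts capture from small stationarity-defect tails ALONE; `DefectCoercivity` (K3)
becomes `0 ≤ C · defect`; the Łojasiewicz loop on `d` carries no information.  Repair: evaluate
the weight at the `Ψ`-coordinates of the point (`leWeight (Ψ⁻¹ (Φ x))`), or pin `Φ` to `Ψ` at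
infinity, or drop the weight on truncated bands.  This file does NOT refute the crux.
-/

noncomputable section

namespace Summit.FinalStateConjecture.FinalStateConjecture.Theorems.SquareIntegrableCapture.Negative

open Literature.Geometry.Lorentzian
open Set Filter Function Topology
open scoped Manifold ContDiff ENNReal

universe u

/-! ### Weighted versus unweighted sup norms -/

section Weight

variable {G : Type*} [NormedAddCommGroup G] [NormedSpace ℝ G]

/-- A uniform bound on the LE weight over `S` bounds the weighted `Cᵏ` sup size by the unweighted
one. [folklore] -/
theorem leSupCkENorm_le_mul_supCkENorm {S : Set E4} {w : ℝ≥0∞} (hw : ∀ x ∈ S, leWeight x ≤ w)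
    (k : ℕ) (f : E4 → G) : leSupCkENorm S k f ≤ w * supCkENorm S k f :=
  iSup₂_le fun _ hm ↦ iSup₂_le fun x hx ↦
    mul_le_mul' (hw x hx) (enorm_iteratedFDeriv_le_supCkENorm hm hx f)

/-- The LE weight is at most `(1 + R)⁻¹` at points with `‖y‖ ≥ R ≥ 0`... stated with `R ≤ ‖y‖`.
[folklore] -/
theorem leWeight_le_of_le {R : ℝ} (hR : 0 ≤ R) {x : E4} (hx : R ≤ ‖E4.spatial x‖) :
    leWeight x ≤ ENNReal.ofReal (1 + R)⁻¹ :=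
  ENNReal.ofReal_le_ofReal (inv_anti₀ (by positivity) (by linarith))

/-- `supCkENorm S k (a • f) ≤ supCkENorm S k f` for `|a| ≤ 1` and `f` of class `Cᵏ` at the points
of `S`. [folklore] -/
theorem supCkENorm_const_smul_le {F : Type*} [NormedAddCommGroup F] [NormedSpace ℝ F]
    {S : Set F} {k : ℕ} {f : F → G} (hf : ∀ x ∈ S, ContDiffAt ℝ k f x) {a : ℝ} (ha : |a| ≤ 1) :
    supCkENorm S k (a • f) ≤ supCkENorm S k f := by
  refine supCkENorm_le_of_forall_le fun m hm x hx ↦ ?_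
  have hm' : (m : WithTop ℕ∞) ≤ k := by exact_mod_cast hm
  rw [iteratedFDeriv_const_smul_apply ((hf x hx).of_le hm'), ← ofReal_norm, norm_smul,
    Real.norm_eq_abs]
  calc ENNReal.ofReal (|a| * ‖iteratedFDeriv ℝ m f x‖)
      ≤ ENNReal.ofReal ‖iteratedFDeriv ℝ m f x‖ := ENNReal.ofReal_le_ofReal (by
        nlinarith [norm_nonneg (iteratedFDeriv ℝ m f x), abs_nonneg a])
    _ = ‖iteratedFDeriv ℝ m f x‖ₑ := ofReal_norm _
    _ ≤ supCkENorm S k f := enorm_iteratedFDeriv_le_supCkENorm hm hx f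

/-- `supCkENorm S k (f − g) ≤ supCkENorm S k f + supCkENorm S k g` for `f`, `g` of class `Cᵏ` at
the points of `S`. [folklore] -/
theorem supCkENorm_sub_le {F : Type*} [NormedAddCommGroup F] [NormedSpace ℝ F]
    {S : Set F} {k : ℕ} {f g : F → G} (hf : ∀ x ∈ S, ContDiffAt ℝ k f x)
    (hg : ∀ x ∈ S, ContDiffAt ℝ k g x) :
    supCkENorm S k (f - g) ≤ supCkENorm S k f + supCkENorm S k g := by
  have hneg : supCkENorm S k (-g) = supCkENorm S k g := by
    simp only [supCkENorm, iteratedFDeriv_neg_apply, enorm_neg]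
  rw [sub_eq_add_neg, ← hneg]
  exact supCkENorm_add_le hf fun x hx ↦ (hg x hx).neg

end Weight

/-! ### The dilation between hyperboloidal Kerr-star domains -/

section Dilate

variable {lam : ℝ}

/-- `y ∈ Kerr.region (λa₀) (λM₀) ↔ λ⁻¹ y ∈ Kerr.region a₀ M₀` (`λ > 0`). [folklore] -/
theorem mem_region_iff_inv_smul_mem (hlam : 0 < lam) (a₀ M₀ : ℝ) (y : E4) :
    y ∈ Kerr.region (lam * a₀) (lam * M₀) ↔ lam⁻¹ • y ∈ Kerr.region a₀ M₀ := by
  rw [← Kerr.mem_region_dilate_iff hlam (x := lam⁻¹ • y), smul_inv_smul₀ hlam.ne']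

/-- The dilation `y ↦ λ⁻¹ y` maps `B♯(λM₀, λa₀).domain` into `B♯(M₀, a₀).domain`; the dilation
MAP is `Subtype.map (fun y ↦ λ⁻¹ • y) (mapsTo_dilate hlam M₀ a₀)` (kept inline, so that this
support file declares no definitions). [folklore] -/
theorem mapsTo_dilate (hlam : 0 < lam) (M₀ a₀ : ℝ) :
    ∀ y : E4, y ∈ (Kerr.hypStarBackground (lam * M₀) (lam * a₀)).domain →
      lam⁻¹ • y ∈ (Kerr.hypStarBackground M₀ a₀).domain :=
  fun y hy ↦ (mem_region_iff_inv_smul_mem hlam a₀ M₀ y).1 hy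

/-- The dilation map is `y ↦ λ⁻¹ y` in coordinates. [folklore] -/
theorem coe_dilate (hlam : 0 < lam) (M₀ a₀ : ℝ)
    (y : (Kerr.hypStarBackground (lam * M₀) (lam * a₀)).domain) :
    (Subtype.map (fun y : E4 ↦ lam⁻¹ • y) (mapsTo_dilate hlam M₀ a₀) y :
      (Kerr.hypStarBackground M₀ a₀).domain) = lam⁻¹ • (y : E4) := rfl

/-- The domains correspond under the dilation: `y ∈ U_λ ↔ λ⁻¹ y ∈ U`. [folklore] -/
theorem dom_dilate (hlam : 0 < lam) (M₀ a₀ : ℝ) (y : E4) :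
    y ∈ (Kerr.hypStarBackground (lam * M₀) (lam * a₀)).domain ↔
      lam⁻¹ • y ∈ (Kerr.hypStarBackground M₀ a₀).domain :=
  mem_region_iff_inv_smul_mem hlam a₀ M₀ y

/-- The reference metrics correspond under the dilation: `g_{λM₀,λa₀}(y) = g_{M₀,a₀}(λ⁻¹ y)`
(Kerr–Schild homothety, `Kerr.bilin_dilate`). [folklore] -/
theorem bilin_dilate (hlam : 0 < lam) (M₀ a₀ : ℝ) (y : E4) :
    (Kerr.hypStarBackground (lam * M₀) (lam * a₀)).bilin y =
      (Kerr.hypStarBackground M₀ a₀).bilin (lam⁻¹ • y) := by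
  change Kerr.bilin (lam * M₀) (lam * a₀) y = Kerr.bilin M₀ a₀ (lam⁻¹ • y)
  conv_lhs => rw [← smul_inv_smul₀ hlam.ne' y]
  exact Kerr.bilin_dilate hlam M₀ a₀ _

/-- The dilation map is surjective. [folklore] -/
theorem surjective_dilate' (hlam : 0 < lam) (M₀ a₀ : ℝ) :
    Surjective (Subtype.map (fun y : E4 ↦ lam⁻¹ • y) (mapsTo_dilate hlam M₀ a₀)) :=
  surjective_dilate (inv_ne_zero hlam.ne') (coe_dilate hlam M₀ a₀) (dom_dilate hlam M₀ a₀)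

/-- The dilation map is injective. [folklore] -/
theorem injective_dilate (hlam : 0 < lam) (M₀ a₀ : ℝ) :
    Injective (Subtype.map (fun y : E4 ↦ lam⁻¹ • y) (mapsTo_dilate hlam M₀ a₀)) :=
  fun _ _ h ↦ Subtype.ext (smul_right_injective E4 (inv_ne_zero hlam.ne')
    (congrArg Subtype.val h :))

end Dilate

/-! ### Chart metrics and deviations in the rescaled spacetime -/

section ConstSmul

variable {𝓢 : Spacetime.{u} 4} {c : ℝ} (hc : 0 < c) {B : ModelBackground}

/-- `(Ψ^*(c g))(x) = c (Ψ^* g)(x)`. [folklore] -/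
theorem chartMetric_constSmul (Ψ : B.domain → 𝓢.carrier) (x : B.domain) :
    (𝓢.constSmul c hc).chartMetric B Ψ x = c • 𝓢.chartMetric B Ψ x := by
  ext v w
  rfl

/-- On the domain, `deviationExtend (c g, B) Ψ = c • chartMetricExtend g Ψ − g₀`. [folklore] -/
theorem deviationExtend_constSmul_eqOn (Ψ : B.domain → 𝓢.carrier) :
    EqOn ((𝓢.constSmul c hc).deviationExtend B Ψ) (c • 𝓢.chartMetricExtend B Ψ - B.bilin)
      (B.domain : Set E4) := by
  intro y hy
  obtain ⟨x, rfl⟩ : ∃ x : B.domain, (x : E4) = y := ⟨⟨y, hy⟩, rfl⟩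
  rw [Spacetime.deviationExtend_coe, Spacetime.deviation_eq_chartMetric_sub, Pi.sub_apply,
    Pi.smul_apply, Spacetime.chartMetricExtend_coe, chartMetric_constSmul]

end ConstSmul

/-! ### The dilated re-charting -/

section Rechart

variable {𝓢 : Spacetime.{u} 4} {M₀ a₀ lam τ : ℝ}
  {Ψ : (Kerr.hypStarBackground M₀ a₀).domain → 𝓢.carrier}

/-- The chart metric of `Ψ ∘ δ_λ` is `y ↦ λ⁻² (Ψ^* g)(λ⁻¹ y)` on the dilated domain. [folklore] -/
theorem chartMetricExtend_comp_dilate (hlam : 0 < lam) (hΨ : ContMDiff 𝓘(ℝ, E4) (𝓡 4) ∞ Ψ) {y : E4}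
    (hy : y ∈ (Kerr.hypStarBackground (lam * M₀) (lam * a₀)).domain) :
    𝓢.chartMetricExtend (Kerr.hypStarBackground (lam * M₀) (lam * a₀))
        (Ψ ∘ Subtype.map (fun y : E4 ↦ lam⁻¹ • y) (mapsTo_dilate hlam M₀ a₀)) y =
      (lam⁻¹ ^ 2) • 𝓢.chartMetricExtend (Kerr.hypStarBackground M₀ a₀) Ψ (lam⁻¹ • y) := by
  have hc : 0 < lam⁻¹ := inv_pos.2 hlam
  obtain ⟨x, rfl⟩ : ∃ x : (Kerr.hypStarBackground (lam * M₀) (lam * a₀)).domain, (x : E4) = y :=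
    ⟨⟨y, hy⟩, rfl⟩
  have h1 := 𝓢.deviation_comp_dilate hc (coe_dilate hlam M₀ a₀) (bilin_dilate hlam M₀ a₀) hΨ x
  rw [Spacetime.deviation_eq_chartMetric_sub, Spacetime.deviation_eq_chartMetric_sub,
    chartMetric_constSmul, bilin_dilate hlam M₀ a₀, coe_dilate hlam M₀ a₀] at h1
  rw [Spacetime.chartMetricExtend_coe, ← coe_dilate hlam M₀ a₀, Spacetime.chartMetricExtend_coe]
  exact sub_left_injective h1

/-- **The dilated re-charting is admissible**: if `Ψ` is an admissible re-charting of its own band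
at `(M₀, a₀)`, then `Ψ ∘ δ_λ` (on `B♯(λM₀, λa₀)`) is one at `(λM₀, λa₀)`. [folklore] -/
theorem isLeafRechart_comp_dilate (hlam : 0 < lam) (h : 𝓢.IsLeafRechart M₀ a₀ Ψ τ M₀ a₀ Ψ) :
    𝓢.IsLeafRechart M₀ a₀ Ψ τ (lam * M₀) (lam * a₀)
      (Ψ ∘ Subtype.map (fun y : E4 ↦ lam⁻¹ • y) (mapsTo_dilate hlam M₀ a₀)) where
  contMDiff := h.contMDiff.comp (contMDiff_dilate (coe_dilate hlam M₀ a₀))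
  contDiffOn := by
    have hF : ContDiffOn ℝ ∞
        (fun y : E4 ↦ 𝓢.chartMetricExtend (Kerr.hypStarBackground M₀ a₀) Ψ (lam⁻¹ • y))
        ((Kerr.hypStarBackground (lam * M₀) (lam * a₀)).domain : Set E4) :=
      h.contDiffOn.comp (contDiff_const_smul lam⁻¹).contDiffOn
        fun y hy ↦ (dom_dilate hlam M₀ a₀ y).1 hy
    exact (hF.const_smul (lam⁻¹ ^ 2)).congr fun y hy ↦
      chartMetricExtend_comp_dilate hlam h.contMDiff hy
  injOn := by
    intro y₁ hy₁ y₂ hy₂ heq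
    exact injective_dilate hlam M₀ a₀ (h.injOn hy₁ hy₂ heq)
  covers := by
    rw [(surjective_dilate' hlam M₀ a₀).range_comp]
    rintro _ ⟨x, -, rfl⟩
    exact mem_range_self x

end Rechart

/-! ### The leaf deviation degenerates -/

section LeafDev

variable {𝓢 : Spacetime.{u} 4} {M₀ a₀ χ τ : ℝ} {k : ℕ}
  {Ψ : (Kerr.hypStarBackground M₀ a₀).domain → 𝓢.carrier}

/-- **Scaling bound for the leaf deviation**: for every `λ ≥ 1`,
`d_k(τ) ≤ (1 + λ M₀)⁻¹ · ‖λ⁻² Ψ^* g − g_{M₀,a₀}‖_{Cᵏ(Ψ⁻¹Ψ(band))}` (test the infimum defining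
`leafDev` on the dilated re-charting `Ψ ∘ δ_λ` with fitted parameters `(λM₀, λa₀)`; its measured set
lies in `{‖y‖ > λM₀}`). [folklore] -/
theorem leafDev_le_dilate (h : 𝓢.IsLeafRechart M₀ a₀ Ψ τ M₀ a₀ Ψ) (hM₀ : 0 < M₀)
    (ha₀ : |a₀| ≤ χ * M₀) {lam : ℝ} (hlam : 1 ≤ lam) :
    𝓢.leafDev M₀ a₀ Ψ χ k τ ≤ ENNReal.ofReal (1 + lam * M₀)⁻¹ *
      supCkENorm
        (Subtype.val '' (Ψ ⁻¹' (Ψ '' (Kerr.hypStarBackground M₀ a₀).timeBand (Icc τ (τ + 1)))))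
        k ((𝓢.constSmul (lam⁻¹ ^ 2) (pow_pos (inv_pos.2 (one_pos.trans_le hlam)) 2)).deviationExtend
          (Kerr.hypStarBackground M₀ a₀) Ψ) := by
  have hlam0 : 0 < lam := one_pos.trans_le hlam
  have hc : 0 < lam⁻¹ := inv_pos.2 hlam0
  have hM : 0 < lam * M₀ := mul_pos hlam0 hM₀
  have ha : |lam * a₀| ≤ χ * (lam * M₀) := by
    rw [abs_mul, abs_of_pos hlam0, mul_left_comm]
    exact mul_le_mul_of_nonneg_left ha₀ hlam0.le
  refine (Spacetime.leafDev_le M₀ a₀ Ψ χ k τ hM ha (isLeafRechart_comp_dilate hlam0 h)).trans ?_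
  -- (1) the weight is `≤ (1 + λM₀)⁻¹` on the measured set `S'` of the dilated re-charting
  have hw : ∀ y ∈ Subtype.val ''
      ((Ψ ∘ Subtype.map (fun y : E4 ↦ lam⁻¹ • y) (mapsTo_dilate hlam0 M₀ a₀)) ⁻¹'
        (Ψ '' (Kerr.hypStarBackground M₀ a₀).timeBand (Icc τ (τ + 1)))),
      leWeight y ≤ ENNReal.ofReal (1 + lam * M₀)⁻¹ := by
    rintro _ ⟨y, -, rfl⟩
    refine leWeight_le_of_le hM.le ?_
    have hy : max (lam * M₀) 0 < Kerr.radius (lam * a₀) (y : E4) := Kerr.mem_region.1 y.2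
    exact ((le_max_left _ _).trans hy.le).trans (Kerr.radius_le_spatialNorm _ _)
  refine (leSupCkENorm_le_mul_supCkENorm hw k _).trans (mul_le_mul_right ?_ _)
  -- (2) transfer the deviation through the dilation
  rw [𝓢.deviationExtend_comp_dilate hc (coe_dilate hlam0 M₀ a₀) (dom_dilate hlam0 M₀ a₀)
    (bilin_dilate hlam0 M₀ a₀) h.contMDiff]
  refine (supCkENorm_comp_smul_le _ k _ hc.ne').trans ?_
  have hmax : max 1 (|lam⁻¹| ^ k) = 1 :=
    max_eq_left (pow_le_one₀ (abs_nonneg _) (by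
      rw [abs_of_pos hc]; exact inv_le_one_of_one_le₀ hlam))
  rw [hmax, ENNReal.ofReal_one, one_mul]
  refine supCkENorm_mono ?_ _ _
  rintro _ ⟨_, ⟨y, hy, rfl⟩, rfl⟩
  exact ⟨Subtype.map (fun y : E4 ↦ lam⁻¹ • y) (mapsTo_dilate hlam0 M₀ a₀) y, hy, rfl⟩

/-- **`Cᵏ` size of the rescaled deviation**: for `0 < c ≤ 1`,
`‖c Ψ^* g − g_{M₀,a₀}‖_{Cᵏ(S)} ≤ ‖Ψ^* g‖_{Cᵏ(S)} + ‖g_{M₀,a₀}‖_{Cᵏ(S)}` on any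
`S ⊆ B♯(M₀,a₀).domain` on which the chart metric is smooth. [folklore] -/
theorem supCkENorm_deviationExtend_constSmul_le {c : ℝ} (hc : 0 < c) (hc1 : c ≤ 1)
    (hreg : ContDiffOn ℝ ∞ (𝓢.chartMetricExtend (Kerr.hypStarBackground M₀ a₀) Ψ)
      ((Kerr.hypStarBackground M₀ a₀).domain : Set E4))
    {S : Set E4} (hS : S ⊆ ((Kerr.hypStarBackground M₀ a₀).domain : Set E4)) :
    supCkENorm S k ((𝓢.constSmul c hc).deviationExtend (Kerr.hypStarBackground M₀ a₀) Ψ) ≤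
      supCkENorm S k (𝓢.chartMetricExtend (Kerr.hypStarBackground M₀ a₀) Ψ) +
        supCkENorm S k (Kerr.bilin M₀ a₀) := by
  have hopen : IsOpen ((Kerr.hypStarBackground M₀ a₀).domain : Set E4) :=
    (Kerr.hypStarBackground M₀ a₀).domain.isOpen
  have hk : ((k : ℕ) : WithTop ℕ∞) ≤ ((⊤ : ℕ∞) : WithTop ℕ∞) := by exact_mod_cast le_top
  have hF : ∀ x ∈ S, ContDiffAt ℝ k (𝓢.chartMetricExtend (Kerr.hypStarBackground M₀ a₀) Ψ) x :=
    fun x hx ↦ ((hreg x (hS hx)).contDiffAt (hopen.mem_nhds (hS hx))).of_le hk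
  have hK : ∀ x ∈ S, ContDiffAt ℝ k (Kerr.bilin M₀ a₀) x := fun x hx ↦
    Kerr.contDiffAt_bilin M₀ a₀ (Kerr.radius_pos_of_mem_region (hS hx))
  calc supCkENorm S k ((𝓢.constSmul c hc).deviationExtend (Kerr.hypStarBackground M₀ a₀) Ψ)
      = supCkENorm S k (c • 𝓢.chartMetricExtend (Kerr.hypStarBackground M₀ a₀) Ψ -
          (Kerr.hypStarBackground M₀ a₀).bilin) :=
        supCkENorm_congr fun x hx ↦ Filter.eventuallyEq_of_mem (hopen.mem_nhds (hS hx))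
          (deviationExtend_constSmul_eqOn hc Ψ)
    _ ≤ supCkENorm S k (c • 𝓢.chartMetricExtend (Kerr.hypStarBackground M₀ a₀) Ψ) +
          supCkENorm S k (Kerr.bilin M₀ a₀) :=
        supCkENorm_sub_le (fun x hx ↦ (hF x hx).const_smul c) hK
    _ ≤ supCkENorm S k (𝓢.chartMetricExtend (Kerr.hypStarBackground M₀ a₀) Ψ) +
          supCkENorm S k (Kerr.bilin M₀ a₀) :=
        add_le_add (supCkENorm_const_smul_le hF (by rw [abs_of_pos hc]; exact hc1)) le_rfl

/-- **The LE-weighted leaf deviation vanishes identically.** If `Ψ` is an admissible re-charting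
of its own unit band at `(M₀, a₀)` (`IsLeafRechart M₀ a₀ Ψ τ M₀ a₀ Ψ`: smooth, smooth chart
metric on the domain, injective on the saturation of the band), `0 < M₀`, `|a₀| ≤ χ M₀`, and
the chart metric `Ψ^* g` and the Kerr metric `g_{M₀,a₀}` have finite `Cᵏ` sup norm on the
saturated band, then
`leafDev 𝓢 M₀ a₀ Ψ χ k τ = 0`: letting `λ → ∞` in `leafDev_le_dilate`. In particular the hypotheses
`leafDev ≤ δ₀` and `∫⁻ leafDev² ≤ η` of `KillingDefectSpacetimeBound.SquareIntegrableCapture`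
carry no information. [folklore] -/
theorem leafDev_eq_zero (h : 𝓢.IsLeafRechart M₀ a₀ Ψ τ M₀ a₀ Ψ) (hM₀ : 0 < M₀)
    (ha₀ : |a₀| ≤ χ * M₀)
    (hΨ : supCkENorm
      (Subtype.val '' (Ψ ⁻¹' (Ψ '' (Kerr.hypStarBackground M₀ a₀).timeBand (Icc τ (τ + 1))))) k
      (𝓢.chartMetricExtend (Kerr.hypStarBackground M₀ a₀) Ψ) ≠ ⊤)
    (hKerr : supCkENorm
      (Subtype.val '' (Ψ ⁻¹' (Ψ '' (Kerr.hypStarBackground M₀ a₀).timeBand (Icc τ (τ + 1))))) k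
      (Kerr.bilin M₀ a₀) ≠ ⊤) :
    𝓢.leafDev M₀ a₀ Ψ χ k τ = 0 := by
  set K : ℝ≥0∞ := supCkENorm
      (Subtype.val '' (Ψ ⁻¹' (Ψ '' (Kerr.hypStarBackground M₀ a₀).timeBand (Icc τ (τ + 1))))) k
      (𝓢.chartMetricExtend (Kerr.hypStarBackground M₀ a₀) Ψ) + supCkENorm
      (Subtype.val '' (Ψ ⁻¹' (Ψ '' (Kerr.hypStarBackground M₀ a₀).timeBand (Icc τ (τ + 1))))) k
      (Kerr.bilin M₀ a₀) with hKdef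
  have hK : K ≠ ⊤ := ENNReal.add_ne_top.2 ⟨hΨ, hKerr⟩
  have hS : Subtype.val '' (Ψ ⁻¹' (Ψ '' (Kerr.hypStarBackground M₀ a₀).timeBand (Icc τ (τ + 1))))
      ⊆ ((Kerr.hypStarBackground M₀ a₀).domain : Set E4) := by
    rintro _ ⟨y, -, rfl⟩
    exact y.2
  -- `d ≤ (1 + (n+1) M₀)⁻¹ K` for every `n : ℕ`
  have hbound : ∀ n : ℕ, 𝓢.leafDev M₀ a₀ Ψ χ k τ ≤
      ENNReal.ofReal (1 + ((n : ℝ) + 1) * M₀)⁻¹ * K := fun n ↦ by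
    have hlam : (1 : ℝ) ≤ (n : ℝ) + 1 := by
      have : (0 : ℝ) ≤ n := n.cast_nonneg
      linarith
    have hlam0 : 0 < (n : ℝ) + 1 := one_pos.trans_le hlam
    refine (leafDev_le_dilate h hM₀ ha₀ hlam).trans (mul_le_mul_right ?_ _)
    exact supCkENorm_deviationExtend_constSmul_le (pow_pos (inv_pos.2 hlam0) 2)
      (pow_le_one₀ (inv_pos.2 hlam0).le (inv_le_one_of_one_le₀ hlam)) h.contDiffOn hS
  -- the right-hand side tends to `0`
  have hlim : Tendsto (fun n : ℕ ↦ ENNReal.ofReal (1 + ((n : ℝ) + 1) * M₀)⁻¹ * K) atTop (𝓝 0) := by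
    have h1 : Tendsto (fun n : ℕ ↦ (1 + ((n : ℝ) + 1) * M₀)⁻¹) atTop (𝓝 0) := by
      refine tendsto_inv_atTop_zero.comp ?_
      refine tendsto_atTop_add_const_left _ 1 ?_
      refine Tendsto.atTop_mul_const hM₀ ?_
      exact tendsto_atTop_add_const_right _ 1 tendsto_natCast_atTop_atTop
    have h2 := ENNReal.tendsto_ofReal h1
    rw [ENNReal.ofReal_zero] at h2
    have h3 := ENNReal.Tendsto.mul_const h2 (Or.inr hK)
    rwa [zero_mul] at h3
  exact le_antisymm (ge_of_tendsto' hlim hbound) zero_le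

/-- **The two `leafDev` hypotheses of `SquareIntegrableCapture` hold for free.** Under the
hypotheses of `leafDev_eq_zero` on every unit band after `τ₁`, for ALL real `δ₀, η` (even `≤ 0`):
`∀ τ ≥ τ₁, d_k(τ) ≤ δ₀` and `∫_{τ > τ₁} d_k(τ)² dτ (= 0) ≤ η` — the literal hypotheses
`∀ τ, τ₁ ≤ τ → leafDev … τ ≤ ENNReal.ofReal δ₀` and
`∫⁻ τ in Ioi τ₁, leafDev … τ ^ 2 ≤ ENNReal.ofReal η` of the route item. [folklore] -/
theorem leafDev_hypotheses_hold {τ₁ : ℝ} (h : ∀ τ, τ₁ ≤ τ → 𝓢.IsLeafRechart M₀ a₀ Ψ τ M₀ a₀ Ψ)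
    (hM₀ : 0 < M₀) (ha₀ : |a₀| ≤ χ * M₀)
    (hΨ : ∀ τ, τ₁ ≤ τ → supCkENorm
      (Subtype.val '' (Ψ ⁻¹' (Ψ '' (Kerr.hypStarBackground M₀ a₀).timeBand (Icc τ (τ + 1))))) k
      (𝓢.chartMetricExtend (Kerr.hypStarBackground M₀ a₀) Ψ) ≠ ⊤)
    (hKerr : ∀ τ, τ₁ ≤ τ → supCkENorm
      (Subtype.val '' (Ψ ⁻¹' (Ψ '' (Kerr.hypStarBackground M₀ a₀).timeBand (Icc τ (τ + 1))))) k
      (Kerr.bilin M₀ a₀) ≠ ⊤) (δ₀ η : ℝ) :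
    (∀ τ, τ₁ ≤ τ → 𝓢.leafDev M₀ a₀ Ψ χ k τ ≤ ENNReal.ofReal δ₀) ∧
      ∫⁻ τ in Ioi τ₁, 𝓢.leafDev M₀ a₀ Ψ χ k τ ^ 2 ≤ ENNReal.ofReal η := by
  have h0 : ∀ τ, τ₁ ≤ τ → 𝓢.leafDev M₀ a₀ Ψ χ k τ = 0 := fun τ hτ ↦
    leafDev_eq_zero (h τ hτ) hM₀ ha₀ (hΨ τ hτ) (hKerr τ hτ)
  refine ⟨fun τ hτ ↦ by rw [h0 τ hτ]; exact zero_le, ?_⟩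
  rw [MeasureTheory.setLIntegral_eq_zero measurableSet_Ioi fun τ hτ ↦ by
    show 𝓢.leafDev M₀ a₀ Ψ χ k τ ^ 2 = 0
    rw [h0 τ (le_of_lt hτ), zero_pow two_ne_zero]]
  exact zero_le

end LeafDev

end Summit.FinalStateConjecture.FinalStateConjecture.Theorems.SquareIntegrableCapture.Negative

end
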